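import Mathlib.Analysis.CStarAlgebra.Matrix
import Mathlib.LinearAlgebra.Matrix.Reindex
import Mathlib.LinearAlgebra.Matrix.Hermitian
import Mathlib.Analysis.InnerProductSpace.PiL2
import Literature.MathematicalPhysics.QuantumLattice.SpinOperators
import HarnessLib

-- provenance: harness21/H21/H21/Prelude/QLatticeAQFT/SpinSystem.lean @ 3921232 (interim HEAD d8f2665); M5 mechanical rewrite
/-!
# Finite quantum spin systems (trunk QLatticeAQFT, item Q3; outline decision Q-D1)

A finite quantum spin system on a finite set of sites `Λ` with local dimension `q` has Hilbert
space `⨂_{x ∈ Λ} ℂ^q ≅ ℓ²(Λ → Fin q)`. Following outline decision Q-D1 we use the concrete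
`ℓ²` picture, so that Mathlib's matrix API (Hermitian matrices, eigenvalues, `PosSemidef`, trace,
`NormedSpace.exp`, the L²-operator norm `Matrix.Norms.L2Operator`) is available:

* `TensorIndex Λ q := Λ → Fin q` (classical configurations), `SpinSpace Λ q := ℓ²(TensorIndex Λ q)`,
  `Op Λ q := Matrix (TensorIndex Λ q) (TensorIndex Λ q) ℂ` (the algebra of observables `𝔄_Λ`),
  `basisVec σ` (product basis);
* locality: `onSite x a` (a single-site matrix `a` acting at `x`), `localOp X A` (a matrix on
  `ℓ²(X → Fin q)` acting on `X ⊆ Λ` tensored with the identity off `X`), the support predicate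
  `IsSupportedOn A X`, `embedOp h` (`X ⊆ Y`), `reindexOp e` (relabelling sites);
* spins: `siteSpin x α = S^α_x`, `totalSpin α = Σ_x S^α_x`, `totalSpinSq = Σ_α (S^α_tot)²`,
  `globalRotation θ = ⨂_x exp(-i θ·S_x)`.

API: `localOp_one/add/smul` (proved), `localOp_mul`, `localOp_conjTranspose`, `onSite_eq_localOp`,
`localOp_embedOp`, `IsSupportedOn.mono/mul/add/star/smul`, `commute_of_disjoint`, `norm_localOp`,
`isSupportedOn_univ`, `siteSpin_commute_of_ne`, `totalSpinSq_isHermitian`.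

Everything is stated for an arbitrary `[Fintype Λ]`; lattices with a unit cell
(`Λ := TorusSite d L × κ`) need no extra code.

## Sources

* O. Bratteli, D. W. Robinson, *Operator Algebras and Quantum Statistical Mechanics II*
  (2nd ed., Springer 1997), §6.2.1 (quantum spin systems, local algebras `𝔄_Λ`, isotony,
  locality).
* B. Nachtergaele, R. Sims, *Lieb–Robinson bounds and the exponential clustering theorem*,
  Comm. Math. Phys. 265 (2006), §2 (set-up: `𝓗_Λ = ⨂ 𝓗_x`, `𝔄_X ⊆ 𝔄_Λ` via `A ↦ A ⊗ 𝟙`).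
* H. Tasaki, *Physics and Mathematics of Quantum Many-Body Systems* (Springer, 2020), §2.2.

## Mathlib / H21 status and design choices

* Mathlib has `PiTensorProduct` but without inner product / matrix API; it has no notion of local
  operator or support in a tensor product of matrix algebras (grep `IsSupportedOn`, `localOp`,
  `onSite`: nothing). We use `Matrix`, `EuclideanSpace`, `EuclideanSpace.single`,
  `Matrix.reindexAlgEquiv`, `Matrix.IsHermitian`, and the scoped L²-operator norm instances
  `Matrix.instL2OpNormedRing` etc. (`open scoped Matrix.Norms.L2Operator`).
* `localOp` is defined by the explicit entrywise formula
  `⟨σ| localOp X A |τ⟩ = [σ = τ off X] · A (σ|_X) (τ|_X)`, exactly the pattern of the accepted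
  `Literature.Computability.Cryptography.placeGate` (`H21/Prelude/CryptoQuantFine/QubitRegister.lean`, a reindexed
  Kronecker product `A ⊗ₖ 1`), which we copy rather than import (different index types:
  qubit registers `Fin n → Bool` vs. configurations `Λ → Fin q`).
* `onSite x a` is likewise given by its explicit formula; `onSite_eq_localOp` relates the two.
-/

noncomputable section

open Matrix Complex
open scoped Matrix.Norms.L2Operator

namespace Literature.MathematicalPhysics.QuantumLattice

section QLattice

/-! ### Configurations, Hilbert space, observables -/

/-- Classical configurations `σ : Λ → Fin q` of a spin system with `q` states per site; they index
the product basis of `⨂_{x∈Λ} ℂ^q`. Bratteli–Robinson II §6.2.1; Nachtergaele–Sims (2006) §2. [cite: NachtergaeleSims2006] -/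
abbrev TensorIndex (Λ : Type*) (q : ℕ) : Type _ := Λ → Fin q

/-- The Hilbert space `𝓗_Λ = ⨂_{x∈Λ} ℂ^q ≅ ℓ²(Λ → Fin q)` of a finite spin system, as a Euclidean
space. Bratteli–Robinson II §6.2.1; Nachtergaele–Sims (2006) §2. [cite: NachtergaeleSims2006] -/
abbrev SpinSpace (Λ : Type*) (q : ℕ) : Type _ := EuclideanSpace ℂ (TensorIndex Λ q)

/-- The algebra of observables `𝔄_Λ = B(𝓗_Λ)` of a finite spin system: square complex matrices
indexed by configurations. Bratteli–Robinson II §6.2.1. [folklore] -/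
abbrev Op (Λ : Type*) (q : ℕ) : Type _ := Matrix (TensorIndex Λ q) (TensorIndex Λ q) ℂ

variable {Λ : Type*} [Fintype Λ] [DecidableEq Λ] {q : ℕ}

/-- The product basis vector `|σ⟩ = ⨂_x |σ_x⟩` of `𝓗_Λ`. Tasaki (2020) §2.2, eq. (2.2.3). [cite: Tasaki2020] -/
def basisVec (σ : TensorIndex Λ q) : SpinSpace Λ q := EuclideanSpace.single σ 1

/-! ### Locality -/

/-- The single-site operator `a` placed at site `x` (identity elsewhere), `𝟙 ⊗ ⋯ ⊗ a ⊗ ⋯ ⊗ 𝟙`: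
`⟨σ| onSite x a |τ⟩ = a (σ x) (τ x)` if `σ = τ` off `x`, else `0`. Tasaki (2020) §2.2,
eq. (2.2.5); Bratteli–Robinson II §6.2.1. [cite: Tasaki2020] -/
def onSite (x : Λ) (a : Matrix (Fin q) (Fin q) ℂ) : Op Λ q :=
  of fun σ τ => if (∀ y, y ≠ x → σ y = τ y) then a (σ x) (τ x) else 0

/-- **Local operators.** The embedding `𝔄_X → 𝔄_Λ`, `A ↦ A ⊗ 𝟙_{Λ∖X}` of the observables on a
region `X ⊆ Λ`: `⟨σ| localOp X A |τ⟩ = A (σ|_X) (τ|_X)` if `σ = τ` off `X`, else `0`.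
Same construction (reindexed Kronecker product `A ⊗ₖ 1`, written entrywise) as the accepted
`Literature.Computability.Cryptography.placeGate` (`H21/Prelude/CryptoQuantFine/QubitRegister.lean`), which places
a gate on a qubit register; copied, not imported, since the index types differ.
Bratteli–Robinson II §6.2.1; Nachtergaele–Sims (2006) §2. [cite: NachtergaeleSims2006] -/
def localOp (X : Finset Λ) (A : Matrix (X → Fin q) (X → Fin q) ℂ) : Op Λ q :=
  of fun σ τ => if (∀ y, y ∉ X → σ y = τ y) then A (fun x => σ x) (fun x => τ x) else 0

/-- `A ∈ 𝔄_X`: the observable `A` is supported on the region `X`, i.e. it is of the form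
`A_X ⊗ 𝟙_{Λ∖X}`. Bratteli–Robinson II §6.2.1; Nachtergaele–Sims (2006) §2. [cite: NachtergaeleSims2006] -/
def IsSupportedOn (A : Op Λ q) (X : Finset Λ) : Prop :=
  A ∈ Set.range (localOp (q := q) X)

/-- Isotony `𝔄_X ↪ 𝔄_Y` for `X ⊆ Y`: `A ↦ A ⊗ 𝟙_{Y∖X}` on the level of the region-indexed matrix
algebras. Bratteli–Robinson II §6.2.1 (isotony). [folklore] -/
def embedOp {X Y : Finset Λ} (h : X ⊆ Y) (A : Matrix (X → Fin q) (X → Fin q) ℂ) :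
    Matrix (Y → Fin q) (Y → Fin q) ℂ :=
  of fun σ τ => if (∀ y : Y, (y : Λ) ∉ X → σ y = τ y) then
    A (fun x => σ ⟨x, h x.2⟩) (fun x => τ ⟨x, h x.2⟩) else 0

/-- Relabelling the sites along `e : Λ ≃ Λ'` induces a ⋆-algebra isomorphism `𝔄_Λ ≃ 𝔄_{Λ'}`
(used for lattice translations and reflections); this is `Matrix.reindexAlgEquiv` along
`σ ↦ σ ∘ e⁻¹`. Bratteli–Robinson II §6.2.1 (covariance). [folklore] -/
def reindexOp {Λ' : Type*} [Fintype Λ'] [DecidableEq Λ'] (e : Λ ≃ Λ') : Op Λ q ≃ₐ[ℂ] Op Λ' q :=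
  Matrix.reindexAlgEquiv ℂ ℂ (Equiv.arrowCongr e (Equiv.refl (Fin q)))

/-! ### Spins -/

/-- The spin operator `S^α_x` (spin `S = n/2`, local dimension `n+1`) at site `x`.
Tasaki (2020) §2.2, eq. (2.2.5). [cite: Tasaki2020] -/
def siteSpin (n : ℕ) (x : Λ) (α : Fin 3) : Op Λ (n + 1) :=
  onSite x (spinVec n α)

/-- The total spin `S^α_tot = Σ_{x∈Λ} S^α_x`. Tasaki (2020) §2.2, eq. (2.2.11). [cite: Tasaki2020] -/
def totalSpin (n : ℕ) (α : Fin 3) : Op Λ (n + 1) :=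
  ∑ x : Λ, siteSpin n x α

/-- The total spin Casimir `(𝐒_tot)² = Σ_α (S^α_tot)²`, whose eigenvalues `S(S+1)` define the total
spin quantum number. Tasaki (2020) §2.2, eq. (2.2.13). [cite: Tasaki2020] -/
def totalSpinSq (n : ℕ) : Op Λ (n + 1) :=
  ∑ α : Fin 3, totalSpin (Λ := Λ) n α * totalSpin n α

/-- The global `SU(2)` rotation `U(θ) = ⨂_{x∈Λ} exp(-i θ·𝐒_x) = exp(-i θ·𝐒_tot)`, defined as the
tensor power of the single-site rotation `spinRotation n θ`, i.e. entrywise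
`⟨σ| U(θ) |τ⟩ = ∏_x ⟨σ_x| exp(-i θ·𝐒) |τ_x⟩`. Tasaki (2020) §2.2, eq. (2.2.12). [cite: Tasaki2020] -/
def globalRotation (n : ℕ) (θ : Fin 3 → ℝ) : Op Λ (n + 1) :=
  of fun σ τ => ∏ x : Λ, spinRotation n θ (σ x) (τ x)

/-! ### API: local operators -/

section localOp

variable (X : Finset Λ)

/-- Entries of `localOp X A` (definitional unfolding). Bratteli–Robinson II §6.2.1. [folklore] -/
theorem localOp_apply (A : Matrix (X → Fin q) (X → Fin q) ℂ) (σ τ : TensorIndex Λ q) :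
    localOp X A σ τ =
      if (∀ y, y ∉ X → σ y = τ y) then A (fun x => σ x) (fun x => τ x) else 0 := rfl

/-- Entries of `onSite x a` (definitional unfolding). Tasaki (2020) §2.2, eq. (2.2.5). [cite: Tasaki2020] -/
theorem onSite_apply (x : Λ) (a : Matrix (Fin q) (Fin q) ℂ) (σ τ : TensorIndex Λ q) :
    onSite x a σ τ = if (∀ y, y ≠ x → σ y = τ y) then a (σ x) (τ x) else 0 := rfl

/-- `𝟙_X ⊗ 𝟙 = 𝟙`. Bratteli–Robinson II §6.2.1. [folklore] -/
@[simp]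
theorem localOp_one : localOp X (1 : Matrix (X → Fin q) (X → Fin q) ℂ) = 1 := by
  ext σ τ
  simp only [localOp_apply, Matrix.one_apply]
  by_cases hστ : σ = τ
  · subst hστ
    simp
  · simp only [hστ, if_false]
    split_ifs with h1 h2
    · refine absurd (funext fun y => ?_) hστ
      by_cases hy : y ∈ X
      · exact congrFun h2 ⟨y, hy⟩
      · exact h1 y hy
    · rfl
    · rfl

/-- `A ↦ A ⊗ 𝟙` is additive. Bratteli–Robinson II §6.2.1. [folklore] -/
theorem localOp_add (A B : Matrix (X → Fin q) (X → Fin q) ℂ) :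
    localOp X (A + B) = localOp X A + localOp X B := by
  ext σ τ
  simp only [localOp_apply, Matrix.add_apply]
  split_ifs <;> simp

/-- `A ↦ A ⊗ 𝟙` commutes with scalars. Bratteli–Robinson II §6.2.1. [folklore] -/
theorem localOp_smul (c : ℂ) (A : Matrix (X → Fin q) (X → Fin q) ℂ) :
    localOp X (c • A) = c • localOp X A := by
  ext σ τ
  simp only [localOp_apply, Matrix.smul_apply, smul_eq_mul]
  split_ifs <;> simp

/-- `localOp X 0 = 0`. Bratteli–Robinson II §6.2.1. [folklore] -/
@[simp]
theorem localOp_zero : localOp X (0 : Matrix (X → Fin q) (X → Fin q) ℂ) = 0 := by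
  ext σ τ
  simp only [localOp_apply, Matrix.zero_apply]
  split_ifs <;> rfl

/-- `A ↦ A ⊗ 𝟙` is multiplicative: `(A ⊗ 𝟙)(B ⊗ 𝟙) = AB ⊗ 𝟙`. Bratteli–Robinson II §6.2.1. [cite: BratteliRobinsonII1997, §6.2.1] -/
def localOp_mul : Prop :=
  ∀ (A B : Matrix (X → Fin q) (X → Fin q) ℂ),
    localOp X (A * B) = localOp X A * localOp X B

/-- `A ↦ A ⊗ 𝟙` is a ⋆-map: `(A ⊗ 𝟙)ᴴ = Aᴴ ⊗ 𝟙`. Bratteli–Robinson II §6.2.1. [folklore] -/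
theorem localOp_conjTranspose (A : Matrix (X → Fin q) (X → Fin q) ℂ) :
    localOp X Aᴴ = (localOp X A)ᴴ := by
  ext σ τ
  simp only [localOp_apply, conjTranspose_apply]
  have h : (∀ y, y ∉ X → σ y = τ y) ↔ (∀ y, y ∉ X → τ y = σ y) :=
    forall_congr' fun y => imp_congr_right fun _ => eq_comm
  rw [if_congr h rfl rfl]
  split_ifs <;> simp

/-- `a ↦ onSite x a` is a ⋆-map. Tasaki (2020) §2.2. [cite: Tasaki2020] -/
theorem onSite_conjTranspose (x : Λ) (a : Matrix (Fin q) (Fin q) ℂ) :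
    onSite x aᴴ = (onSite x a)ᴴ := by
  ext σ τ
  simp only [onSite_apply, conjTranspose_apply]
  have h : (∀ y, y ≠ x → σ y = τ y) ↔ (∀ y, y ≠ x → τ y = σ y) :=
    forall_congr' fun y => imp_congr_right fun _ => eq_comm
  rw [if_congr h rfl rfl]
  split_ifs <;> simp

/-- `A ↦ A ⊗ 𝟙` is injective (for `q ≠ 0`, i.e. nonempty configuration space).
Bratteli–Robinson II §6.2.1. [cite: BratteliRobinsonII1997, §6.2.1] -/
def localOp_injective : Prop :=
  ∀ [NeZero q],
    Function.Injective (localOp (q := q) X)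

/-- A single-site operator at `x` is the local operator on the region `{x}` obtained by
transporting `a` along `({x} → Fin q) ≃ Fin q`. Tasaki (2020) §2.2, eq. (2.2.5). [cite: Tasaki2020] -/
def onSite_eq_localOp : Prop :=
  ∀ (x : Λ) (a : Matrix (Fin q) (Fin q) ℂ),
    onSite x a = localOp {x}
      (Matrix.reindex (Equiv.funUnique ({x} : Finset Λ) (Fin q)).symm
        (Equiv.funUnique ({x} : Finset Λ) (Fin q)).symm a)

/-- Isotony is compatible with the embeddings into `𝔄_Λ`: `(A ⊗ 𝟙_{Y∖X}) ⊗ 𝟙_{Λ∖Y} = A ⊗ 𝟙_{Λ∖X}`.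
Bratteli–Robinson II §6.2.1. [cite: BratteliRobinsonII1997, §6.2.1] -/
def localOp_embedOp : Prop :=
  ∀ {X Y : Finset Λ} (h : X ⊆ Y) (A : Matrix (X → Fin q) (X → Fin q) ℂ),
    localOp Y (embedOp h A) = localOp X A

/-- The L²-operator norm is preserved by `A ↦ A ⊗ 𝟙` (for `q ≠ 0`): `‖A ⊗ 𝟙‖ = ‖A‖`.
Nachtergaele–Sims (2006) §2. [cite: NachtergaeleSims2006] -/
def norm_localOp : Prop :=
  ∀ [NeZero q] (A : Matrix (X → Fin q) (X → Fin q) ℂ),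
    ‖localOp X A‖ = ‖A‖

end localOp

/-! ### API: supports -/

/-- Local operators are supported on their region. Bratteli–Robinson II §6.2.1. [folklore] -/
theorem isSupportedOn_localOp (X : Finset Λ) (A : Matrix (X → Fin q) (X → Fin q) ℂ) :
    IsSupportedOn (localOp X A) X := ⟨A, rfl⟩

/-- Single-site operators are supported on `{x}`. Tasaki (2020) §2.2. [cite: Tasaki2020] -/
def isSupportedOn_onSite : Prop :=
  ∀ (x : Λ) (a : Matrix (Fin q) (Fin q) ℂ),
    IsSupportedOn (onSite x a) {x}

/- interim proof relied on results that are now named facts (D-0014); demoted to a fact by the M5 import, proof preserved: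
:= ⟨_, (onSite_eq_localOp x a).symm⟩
-/

/-- Every observable is supported on the whole volume: `𝔄_Λ = localOp univ (𝔄_univ)`.
Bratteli–Robinson II §6.2.1. [cite: BratteliRobinsonII1997, §6.2.1] -/
def isSupportedOn_univ : Prop :=
  ∀ (A : Op Λ q),
    IsSupportedOn A Finset.univ

/-- The identity is supported on every region. Bratteli–Robinson II §6.2.1. [folklore] -/
theorem IsSupportedOn.one (X : Finset Λ) : IsSupportedOn (1 : Op Λ q) X :=
  ⟨1, localOp_one X⟩

/-- Zero is supported on every region. Bratteli–Robinson II §6.2.1. [folklore] -/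
theorem IsSupportedOn.zero (X : Finset Λ) : IsSupportedOn (0 : Op Λ q) X :=
  ⟨0, localOp_zero X⟩

/-- Isotony: `X ⊆ Y → 𝔄_X ⊆ 𝔄_Y`. Bratteli–Robinson II §6.2.1, eq. (isotony). [folklore] -/
def IsSupportedOn.mono : Prop :=
  ∀ {A : Op Λ q} {X Y : Finset Λ} (hA : IsSupportedOn A X) (h : X ⊆ Y),
    IsSupportedOn A Y

/- interim proof relied on results that are now named facts (D-0014); demoted to a fact by the M5 import, proof preserved:
:= by
  obtain ⟨A, rfl⟩ := hA
  exact ⟨embedOp h A, localOp_embedOp h A⟩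
-/

/-- `𝔄_X` is closed under multiplication. Bratteli–Robinson II §6.2.1. [folklore] -/
def IsSupportedOn.mul : Prop :=
  ∀ {A B : Op Λ q} {X : Finset Λ} (hA : IsSupportedOn A X) (hB : IsSupportedOn B X),
    IsSupportedOn (A * B) X

/- interim proof relied on results that are now named facts (D-0014); demoted to a fact by the M5 import, proof preserved:
:= by
  obtain ⟨A, rfl⟩ := hA
  obtain ⟨B, rfl⟩ := hB
  exact ⟨A * B, localOp_mul X A B⟩
-/

/-- `𝔄_X` is closed under addition. Bratteli–Robinson II §6.2.1. [folklore] -/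
theorem IsSupportedOn.add {A B : Op Λ q} {X : Finset Λ} (hA : IsSupportedOn A X)
    (hB : IsSupportedOn B X) : IsSupportedOn (A + B) X := by
  obtain ⟨A, rfl⟩ := hA
  obtain ⟨B, rfl⟩ := hB
  exact ⟨A + B, localOp_add X A B⟩

/-- `𝔄_X` is closed under scalar multiplication. Bratteli–Robinson II §6.2.1. [folklore] -/
theorem IsSupportedOn.smul {A : Op Λ q} {X : Finset Λ} (hA : IsSupportedOn A X) (c : ℂ) :
    IsSupportedOn (c • A) X := by
  obtain ⟨A, rfl⟩ := hA
  exact ⟨c • A, localOp_smul X c A⟩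

/-- `𝔄_X` is closed under adjoints. Bratteli–Robinson II §6.2.1. [folklore] -/
theorem IsSupportedOn.star {A : Op Λ q} {X : Finset Λ} (hA : IsSupportedOn A X) :
    IsSupportedOn (star A) X := by
  obtain ⟨A, rfl⟩ := hA
  exact ⟨Aᴴ, localOp_conjTranspose X A⟩

/-- `𝔄_X` is closed under finite sums. Bratteli–Robinson II §6.2.1. [folklore] -/
theorem IsSupportedOn.sum {ι : Type*} (s : Finset ι) {A : ι → Op Λ q} {X : Finset Λ}
    (hA : ∀ i ∈ s, IsSupportedOn (A i) X) : IsSupportedOn (∑ i ∈ s, A i) X := by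
  classical
  induction s using Finset.induction_on with
  | empty => simpa using IsSupportedOn.zero X
  | insert i s hi ih =>
    rw [Finset.sum_insert hi]
    exact (hA i (Finset.mem_insert_self i s)).add
      (ih fun j hj => hA j (Finset.mem_insert_of_mem hj))

/-- **Locality**: observables with disjoint supports commute, `[𝔄_X, 𝔄_Y] = 0` for `X ∩ Y = ∅`.
Bratteli–Robinson II §6.2.1; Nachtergaele–Sims (2006) §2. Same statement as the accepted
`Literature.Computability.Cryptography.placeGate_comm_of_disjoint`. [cite: NachtergaeleSims2006] -/
def commute_of_disjoint : Prop :=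
  ∀ {A B : Op Λ q} {X Y : Finset Λ} (hA : IsSupportedOn A X) (hB : IsSupportedOn B Y) (h : Disjoint X Y),
    Commute A B

/-! ### API: spins -/

/-- Spin operators at distinct sites commute: `[S^α_x, S^β_y] = 0` for `x ≠ y`.
Tasaki (2020) §2.2, eq. (2.2.6). [cite: Tasaki2020] -/
def siteSpin_commute_of_ne : Prop :=
  ∀ (n : ℕ) {x y : Λ} (hxy : x ≠ y) (α β : Fin 3),
    Commute (siteSpin n x α : Op Λ (n + 1)) (siteSpin n y β)

/- interim proof relied on results that are now named facts (D-0014); demoted to a fact by the M5 import, proof preserved: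
:=
  commute_of_disjoint (isSupportedOn_onSite x _) (isSupportedOn_onSite y _)
    (Finset.disjoint_singleton.mpr hxy)
-/

/-- Site spin operators are Hermitian. Tasaki (2020) §2.2. [cite: Tasaki2020] -/
theorem siteSpin_isHermitian (n : ℕ) (x : Λ) (α : Fin 3) :
    (siteSpin n x α : Op Λ (n + 1)).IsHermitian := by
  unfold siteSpin
  rw [IsHermitian, ← onSite_conjTranspose, (spinVec_isHermitian n α).eq]

/-- The total spin components `S^α_tot` are Hermitian. Tasaki (2020) §2.2. [cite: Tasaki2020] -/
theorem totalSpin_isHermitian (n : ℕ) (α : Fin 3) :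
    (totalSpin n α : Op Λ (n + 1)).IsHermitian := by
  unfold totalSpin
  rw [IsHermitian, conjTranspose_sum]
  exact Finset.sum_congr rfl fun x _ => (siteSpin_isHermitian n x α).eq

/-- The total spin Casimir `(𝐒_tot)²` is Hermitian. Tasaki (2020) §2.2, eq. (2.2.13). [cite: Tasaki2020] -/
theorem totalSpinSq_isHermitian (n : ℕ) : (totalSpinSq n : Op Λ (n + 1)).IsHermitian := by
  unfold totalSpinSq
  rw [IsHermitian, conjTranspose_sum]
  refine Finset.sum_congr rfl fun α _ => ?_
  rw [conjTranspose_mul, (totalSpin_isHermitian n α).eq]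

end QLattice

end Literature.MathematicalPhysics.QuantumLattice
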